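import Literature.Probability.LatticeModels.KilledWalkLaplacian
import Mathlib.Topology.MetricSpace.HausdorffDistance
import Mathlib.Analysis.Convex.Segment
import Mathlib.Analysis.Normed.Affine.Convex
import Mathlib.Analysis.Complex.Norm
import Mathlib.Algebra.Order.Floor.Ring
import HarnessLib

/-!
# Nearest-point segment geometry and the lattice staircase
(line `symplectic-fermion-anchor`, crux `SAWLoopFugacityFlow.AvoidanceLimit`, stmt-CriticalPhenomena-10649)

Two elementary geometric bricks behind the straight final approach `L_Ω(u)` of the walls in
Chelkak's hub factorisation (Chelkak 2016, Remark 2.5 / Lemma 3.2): from an interior point `p`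
of a domain to its nearest boundary point `q`.

* `infDist_eq_dist_of_mem_segment` — if `dist p q = infDist p Sᶜ` with `p ∈ S`, `q ∉ S`, then along
  the segment `[p, q]` the distance to the complement is `dist w q` and the tangent ball
  `ball w (dist w q)` stays inside `S` (it lies in the maximal ball `ball p (dist p q) ⊆ S` by the
  triangle inequality, the distances `dist p w + dist w q = dist p q` being additive on the
  segment);
* `exists_staircase_walk` — the lattice staircase ("digital segment"): a nearest-neighbour walk of
  `ℤ²` from `a` to `z` with the taxicab number `|Δx| + |Δy|` of steps, all of whose sites lie
  within Euclidean distance `1` of the real segment `[a, z] ⊆ ℂ`.  The `k`-th site has made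
  `I k = round (k |Δx| / N)` horizontal and `k - I k` vertical unit steps (`N = |Δx| + |Δy|`); both
  of its coordinates differ from those of the point of parameter `t = k / N` on the segment by
  `|I k - k |Δx| / N| ≤ 1/2`, whence the distance bound `√2 / 2 ≤ 1`.

Pure metric geometry / `SimpleGraph.Walk` bookkeeping; no definitions. [cite: Chelkak2016, Remark 2.5]
-/

noncomputable section

open scoped BigOperators Classical
open Finset Literature.Probability.LatticeModels

namespace Summit.CriticalPhenomena.SAWScalingLimit.Theorems.AvoidanceLimit.Anchor

/-- **Nearest-point segment geometry.** Let `S ⊆ ℂ`, `p ∈ S`, `q ∉ S` with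
`dist p q = infDist p Sᶜ` (so `q` is a nearest point of the complement). Then for every `w` on the
segment `[p, q]`, `infDist w Sᶜ = dist w q` and `ball w (dist w q) ⊆ S`: the ball lies in the
maximal ball `ball p (dist p q) ⊆ S` since `dist p w + dist w q = dist p q` on the segment, so no
point of `Sᶜ` is closer to `w` than `q`. (The openness hypothesis is not used.)
[cite: Chelkak2016, Remark 2.5] -/
theorem infDist_eq_dist_of_mem_segment :
    ∀ (S : Set ℂ) (p q : ℂ), IsOpen S → p ∈ S → q ∉ S → dist p q = Metric.infDist p Sᶜ →
      ∀ w ∈ segment ℝ p q, Metric.infDist w Sᶜ = dist w q ∧ Metric.ball w (dist w q) ⊆ S := by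
  intro S p q _hS _hp hq hpq w hw
  have hqc : q ∈ Sᶜ := hq
  -- distances are additive along the segment
  have hadd : dist p w + dist w q = dist p q := dist_add_dist_of_mem_segment hw
  -- the tangent ball at `w` lies in the maximal ball at `p`, hence in `S`
  have hball : Metric.ball w (dist w q) ⊆ S := by
    refine Set.Subset.trans ?_ (Metric.ball_infDist_compl_subset (x := p) (s := S))
    intro y hy
    rw [Metric.mem_ball] at hy ⊢
    calc dist y p ≤ dist y w + dist w p := dist_triangle _ _ _
      _ < dist w q + dist w p := by linarith
      _ = dist p q := by rw [dist_comm w p]; linarith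
      _ = Metric.infDist p Sᶜ := hpq
  refine ⟨le_antisymm (Metric.infDist_le_dist_of_mem hqc) ?_, hball⟩
  rw [Metric.le_infDist ⟨q, hqc⟩]
  intro y hy
  by_contra h
  push Not at h
  exact hy (hball (Metric.mem_ball'.2 h))

/-- A chain of adjacent vertices `f 0 ∼ f 1 ∼ ⋯ ∼ f n` of a simple graph is traced by a walk of
length `n` from `f 0` to `f n` whose support consists of the `f k`, `k ≤ n`. [folklore] -/
private theorem exists_walk_of_chain {V : Type*} {G : SimpleGraph V} (n : ℕ) (f : ℕ → V)
    (h : ∀ k < n, G.Adj (f k) (f (k + 1))) :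
    ∃ w : G.Walk (f 0) (f n), w.length = n ∧ ∀ v ∈ w.support, ∃ k ≤ n, f k = v := by
  induction n generalizing f with
  | zero =>
    refine ⟨SimpleGraph.Walk.nil, rfl, fun v hv => ⟨0, le_rfl, ?_⟩⟩
    rw [SimpleGraph.Walk.support_nil, List.mem_singleton] at hv
    exact hv.symm
  | succ n ih =>
    obtain ⟨w, hw, hs⟩ := ih (fun k => f (k + 1)) (fun k hk => h (k + 1) (by omega))
    refine ⟨SimpleGraph.Walk.cons (h 0 (by omega)) w, by simp [hw], fun v hv => ?_⟩
    rw [SimpleGraph.Walk.support_cons, List.mem_cons] at hv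
    rcases hv with rfl | hv
    · exact ⟨0, by omega, rfl⟩
    · obtain ⟨k, hk, rfl⟩ := hs v hv
      exact ⟨k + 1, by omega, rfl⟩

/-- Adding a signed unit coordinate vector is a nearest-neighbour step of `ℤ²`. [folklore] -/
private theorem adj_add_single (x : Site 2) (i : Fin 2) {s : ℤ} (hs : s = 1 ∨ s = -1) :
    (zdGraph 2).Adj x (x + Pi.single i s) := by
  rcases hs with rfl | rfl
  · simpa [SRW.stepVec] using SRW.adj_add_stepVec x (i, true)
  · simpa [SRW.stepVec, Pi.single_neg] using SRW.adj_add_stepVec x (i, false)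

/-- **The lattice staircase along a segment.** For any two sites `a, z ∈ ℤ²` there is a
nearest-neighbour walk from `a` to `z` with exactly `|z₀ - a₀| + |z₁ - a₁|` steps all of whose
sites lie within Euclidean distance `1` of the segment `[a, z] ⊆ ℂ`: after `k` steps the walk has
made `I k = ⌊k |Δx| / N + 1/2⌋` horizontal and `k - I k` vertical unit steps (towards `z`), and
both coordinates of this site differ from those of the point of parameter `t = k / N` of the
segment by `|I k - k |Δx| / N| ≤ 1/2`. [folklore] -/
theorem exists_staircase_walk :
    ∀ (a z : Site 2), ∃ π : (zdGraph 2).Walk a z, π.length = (|z 0 - a 0| + |z 1 - a 1|).toNat ∧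
      ∀ v ∈ π.support, ∃ t ∈ Set.Icc (0 : ℝ) 1,
        dist (Site.toComplex v) (Site.toComplex a + t * (Site.toComplex z - Site.toComplex a)) ≤ 1 := by
  intro a z
  -- taxicab data: displacements, their absolute values and signs, the number of steps
  set dx : ℤ := z 0 - a 0 with hdx
  set dy : ℤ := z 1 - a 1 with hdy
  set p : ℤ := |dx| with hp
  set q : ℤ := |dy| with hq
  set N : ℤ := p + q with hN
  have hp0 : 0 ≤ p := abs_nonneg dx
  have hq0 : 0 ≤ q := abs_nonneg dy
  have hN0 : 0 ≤ N := add_nonneg hp0 hq0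
  set sx : ℤ := if 0 ≤ dx then 1 else -1 with hsx
  set sy : ℤ := if 0 ≤ dy then 1 else -1 with hsy
  have hsx1 : sx = 1 ∨ sx = -1 := by
    by_cases h : 0 ≤ dx
    · exact Or.inl (if_pos h)
    · exact Or.inr (if_neg h)
  have hsy1 : sy = 1 ∨ sy = -1 := by
    by_cases h : 0 ≤ dy
    · exact Or.inl (if_pos h)
    · exact Or.inr (if_neg h)
  have hsxp : sx * p = dx := by
    by_cases h : 0 ≤ dx
    · rw [hsx, if_pos h, hp, abs_of_nonneg h, one_mul]
    · rw [hsx, if_neg h, hp, abs_of_neg (lt_of_not_ge h)]; ring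
  have hsyq : sy * q = dy := by
    by_cases h : 0 ≤ dy
    · rw [hsy, if_pos h, hq, abs_of_nonneg h, one_mul]
    · rw [hsy, if_neg h, hq, abs_of_neg (lt_of_not_ge h)]; ring
  -- degenerate case `N = 0`: `a = z`, the trivial walk
  rcases hN0.eq_or_lt with hN00 | hNpos
  · have hp00 : p = 0 := by omega
    have hq00 : q = 0 := by omega
    have hdx0 : dx = 0 := abs_eq_zero.mp hp00
    have hdy0 : dy = 0 := abs_eq_zero.mp hq00
    have haz : a = z := by
      funext i
      fin_cases i
      · show a 0 = z 0
        omega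
      · show a 1 = z 1
        omega
    subst haz
    refine ⟨SimpleGraph.Walk.nil, ?_, ?_⟩
    · rw [SimpleGraph.Walk.length_nil, ← hN00]
      rfl
    · intro v hv
      rw [SimpleGraph.Walk.support_nil, List.mem_singleton] at hv
      subst hv
      exact ⟨0, ⟨le_rfl, zero_le_one⟩, by simp⟩
  -- the staircase sites
  set ρ : ℝ := (p : ℝ) / (N : ℝ) with hρ
  have hNr : (0 : ℝ) < N := by exact_mod_cast hNpos
  have hρ0 : 0 ≤ ρ := div_nonneg (by exact_mod_cast hp0) hNr.le
  have hρ1 : ρ ≤ 1 := by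
    rw [hρ, div_le_one hNr]
    exact_mod_cast (show p ≤ N by omega)
  set I : ℕ → ℤ := fun k => ⌊(k : ℝ) * ρ + 1 / 2⌋ with hI
  have hIle : ∀ k : ℕ, (I k : ℝ) ≤ k * ρ + 1 / 2 := fun k => Int.floor_le _
  have hIgt : ∀ k : ℕ, (k : ℝ) * ρ + 1 / 2 < I k + 1 := fun k => Int.lt_floor_add_one _
  set f : ℕ → Site 2 := fun k => ![a 0 + sx * I k, a 1 + sy * ((k : ℤ) - I k)] with hf
  have hf0 : ∀ k : ℕ, f k 0 = a 0 + sx * I k := fun k => rfl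
  have hf1 : ∀ k : ℕ, f k 1 = a 1 + sy * ((k : ℤ) - I k) := fun k => rfl
  -- one step: `I` increases by `0` (vertical step) or `1` (horizontal step)
  have hstep : ∀ k : ℕ, I (k + 1) = I k ∨ I (k + 1) = I k + 1 := by
    intro k
    have h1 := hIle k
    have h2 := hIgt k
    have h3 := hIle (k + 1)
    have h4 := hIgt (k + 1)
    push_cast at h3 h4
    have h5 : (I k : ℝ) - 1 < I (k + 1) := by nlinarith
    have h6 : (I (k + 1) : ℝ) < I k + 2 := by nlinarith
    have h7 : I k - 1 < I (k + 1) := by exact_mod_cast h5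
    have h8 : I (k + 1) < I k + 2 := by exact_mod_cast h6
    omega
  have hadj : ∀ k < N.toNat, (zdGraph 2).Adj (f k) (f (k + 1)) := by
    intro k _hk
    rcases hstep k with h | h
    · -- vertical step
      have : f (k + 1) = f k + Pi.single 1 sy := by
        funext i
        fin_cases i
        · simp [hf0, h]
        · simp [hf1, h]
          ring
      rw [this]
      exact adj_add_single (f k) 1 hsy1
    · -- horizontal step
      have : f (k + 1) = f k + Pi.single 0 sx := by
        funext i
        fin_cases i
        · simp [hf0, h]
          ring
        · simp [hf1, h]
      rw [this]
      exact adj_add_single (f k) 0 hsx1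
  -- endpoints
  have hI0 : I 0 = 0 := by
    have h1 := hIle 0
    have h2 := hIgt 0
    push_cast at h1 h2
    have h3 : (I 0 : ℝ) < 1 := by linarith
    have h4 : (-1 : ℝ) < I 0 := by linarith
    have h5 : I 0 < 1 := by exact_mod_cast h3
    have h6 : -1 < I 0 := by exact_mod_cast h4
    omega
  have hnN : ((N.toNat : ℕ) : ℤ) = N := Int.toNat_of_nonneg hN0
  have hnNr : ((N.toNat : ℕ) : ℝ) = N := by exact_mod_cast hnN
  have hIN : I N.toNat = p := by
    have h1 := hIle N.toNat
    have h2 := hIgt N.toNat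
    rw [hnNr] at h1 h2
    have hNρ : (N : ℝ) * ρ = p := by
      rw [hρ]; field_simp
    rw [hNρ] at h1 h2
    have h3 : (I N.toNat : ℝ) < p + 1 := by linarith
    have h4 : (p : ℝ) - 1 < I N.toNat := by linarith
    have h5 : I N.toNat < p + 1 := by exact_mod_cast h3
    have h6 : p - 1 < I N.toNat := by exact_mod_cast h4
    omega
  have hfa : f 0 = a := by
    funext i
    fin_cases i
    · simp [hf0, hI0]
    · simp [hf1, hI0]
  have hfz : f N.toNat = z := by
    funext i
    fin_cases i
    · simp only [hf0, hIN, hsxp, Fin.zero_eta]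
      omega
    · simp only [hf1, hIN, hnN, Fin.mk_one]
      rw [show N - p = q by omega, hsyq]
      omega
  -- the walk
  obtain ⟨w, hwlen, hwsupp⟩ := exists_walk_of_chain N.toNat f hadj
  refine ⟨w.copy hfa hfz, ?_, ?_⟩
  · rw [SimpleGraph.Walk.length_copy, hwlen]
  · intro v hv
    rw [SimpleGraph.Walk.support_copy] at hv
    obtain ⟨k, hk, rfl⟩ := hwsupp v hv
    have hkN : (k : ℝ) ≤ N := by
      rw [← hnNr]; exact_mod_cast hk
    refine ⟨k / N, ⟨div_nonneg k.cast_nonneg hNr.le, (div_le_one hNr).2 hkN⟩, ?_⟩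
    -- both coordinate errors are `± (I k - k ρ)`, of absolute value `≤ 1/2`
    have h1 := hIle k
    have h2 := hIgt k
    set e : ℝ := (I k : ℝ) - k * ρ with he
    have he1 : |e| ≤ 1 / 2 := abs_le.2 ⟨by linarith, by linarith⟩
    have hsxr : ((sx : ℤ) : ℝ) = 1 ∨ ((sx : ℤ) : ℝ) = -1 := by
      rcases hsx1 with h | h
      · left; exact_mod_cast h
      · right; exact_mod_cast h
    have hsyr : ((sy : ℤ) : ℝ) = 1 ∨ ((sy : ℤ) : ℝ) = -1 := by
      rcases hsy1 with h | h
      · left; exact_mod_cast h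
      · right; exact_mod_cast h
    have hdxr : ((dx : ℤ) : ℝ) = sx * p := by exact_mod_cast hsxp.symm
    have hdyr : ((dy : ℤ) : ℝ) = sy * q := by exact_mod_cast hsyq.symm
    have hqr : (q : ℝ) = N - p := by
      have : q = N - p := by omega
      exact_mod_cast this
    have hre : (Site.toComplex (f k)).re -
        (Site.toComplex a + (k / N : ℝ) * (Site.toComplex z - Site.toComplex a)).re = sx * e := by
      have hz0 : ((z 0 : ℤ) : ℝ) = a 0 + sx * p := by
        have : z 0 = a 0 + dx := by omega
        rw [this]; push_cast; rw [hdxr]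
      simp only [Site.toComplex_re, hf0, Complex.add_re, Complex.sub_re, Complex.re_ofReal_mul]
      push_cast
      rw [hz0, he, hρ]
      field_simp
      ring
    have him : (Site.toComplex (f k)).im -
        (Site.toComplex a + (k / N : ℝ) * (Site.toComplex z - Site.toComplex a)).im = -(sy * e) := by
      have hz1 : ((z 1 : ℤ) : ℝ) = a 1 + sy * q := by
        have : z 1 = a 1 + dy := by omega
        rw [this]; push_cast; rw [hdyr]
      simp only [Site.toComplex_im, hf1, Complex.add_im, Complex.sub_im, Complex.im_ofReal_mul]
      push_cast
      rw [hz1, he, hρ, hqr]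
      field_simp
      ring
    have hre2 : ((Site.toComplex (f k)).re -
        (Site.toComplex a + (k / N : ℝ) * (Site.toComplex z - Site.toComplex a)).re) ^ 2 ≤ 1 / 4 := by
      rw [hre]
      have : (sx : ℝ) ^ 2 = 1 := by rcases hsxr with h | h <;> rw [h] <;> norm_num
      rw [mul_pow, this, one_mul, ← sq_abs]
      nlinarith [abs_nonneg e]
    have him2 : ((Site.toComplex (f k)).im -
        (Site.toComplex a + (k / N : ℝ) * (Site.toComplex z - Site.toComplex a)).im) ^ 2 ≤ 1 / 4 := by
      rw [him]
      have : (sy : ℝ) ^ 2 = 1 := by rcases hsyr with h | h <;> rw [h] <;> norm_num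
      rw [neg_pow_two, mul_pow, this, one_mul, ← sq_abs]
      nlinarith [abs_nonneg e]
    rw [Complex.dist_eq_re_im, Real.sqrt_le_left zero_le_one, one_pow]
    linarith

end Summit.CriticalPhenomena.SAWScalingLimit.Theorems.AvoidanceLimit.Anchor

end
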